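import Summits.AtomisticToContinuum.Crystallization.Theorems.FrustratedLawDichotomyAtlasReachLedger
import Summits.AtomisticToContinuum.Crystallization.Theorems.FrustratedLawDichotomyTransportPriceSurplus

/-!
# FrustratedLawDichotomy · crux `AperiodicFrustratedLawGap` (stmt-AtomisticToContinuum-27623) — THE REACH THEOREM WITH THE SHARING LEDGER:
# floors and cap read on the BALL-AVERAGED root energy (decomp-a2c, hand-2 g50, structural share #134; the general lemma #132 specialised to the
# tree's own sharing transport of generation 3)

#132 `…AtlasReachLedger.coherentMassExclusion_of_floorsL` takes ANY null ledger `Φ`.  The tree has held, since generation 3, the one transport whose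
ledger AVERAGES the root energy over a ball: `…TransportPriceSurplus.sharing_transport` (the root sends a Giry-measurable quantity `g ν / ν(B̄_r(0))` to each
atom of its closed `r`-ball; jointly measurable; out-flow `g ν`; in-flow `∫⁻_{B̄_r(0)} g(θ_y ν)/(θ_y ν)(B̄_r(0)) dν(y)`), together with the measurable surrogate
`…exists_measurable_rootEnergy_surrogate` of `rootEnergy − e`.  Sharing the SHIFTED energy `rootEnergy + c₀ ≥ 0` (`c₀ = (250/12)(10/7)⁶`, route-own floor
`…TransportPriceLocal.rootEnergy_add_c0_nonneg`; bounded out-flow by `…rootEnergy_le_C0`) gives a null ledger `Φ = net F 0` with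
  `rootEnergy μ + Φ μ = ballAvgEnergy r μ := Σ_{atoms y ∈ B̄_r(0)} (rootEnergy(θ_y μ) + c₀)/#(atoms of μ in B̄_r(y)) − c₀`
at every rooted `7/10`-hard-core `μ` (`transported_eq_ballAvgEnergy`) — the SENDER-NORMALISED BALL AVERAGE of the site energies around the root.  Hence:
* ★★ `coherentMassExclusion_of_ballAvg` (any radius `r > 0`): row floors `e⋆ + m_i ≤ ballAvgEnergy r μ` at the rooted hard-core NASH configurations of row
  `i`, and the cap `e⋆ − ballAvgEnergy r μ ≤ D` ONLY at rooted hard-core NASH configurations outside every row, give F(η) = `CoherentMassExclusion n K η` for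
  `η ≤ reach m D`; ★ `offAtlasMass_ge_of_ballAvg`: the energy–mass inequality `P(U) ≥ (m − ε)/(m + D)` for every (a)(b)(e) law with `E_P ≤ e⋆ + ε`;
  junction `aperiodicFrustratedLawGap_of_offAtlasMassGap_ballAvg` via (404) massSplit.
WHY THIS LEDGER (desk record of this generation, STATUS 02:17Z, HOME/decomp-a2c-hand-2/g50/num/NASHSLOT-desk.md §5): the three cap-floor witnesses of record
((410) 0.613, (434) 0.24888, hand-1 (H6) 0.18457) and the dilated-shell / knife-edge / jammed families all have B(11/10)-ball averages ≥ e_fcc − 6·10⁻⁴ although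
their ROOT sites read up to +0.68 below e⋆: an over-bound root is surrounded by the atoms that pay for it.  So the cap slot of THIS file — «no rooted hard-core Nash
`11/10`-ball has average site energy below `e⋆ − D`», a LOCAL AVERAGED crystallization inequality — is the one no desk adversary fences; its certificate is K2.
HONEST LABELS: bookkeeping/junction only — no numeric `D` is claimed; A(η) untouched; the row floors are in AVERAGED currency (a K-file emits the template's mean
site excess over the ball, not the root margin alone).  ONE plain real-valued `def` (`ballAvgEnergy`, the displayed functional; not a Prop, no instance /
notation / option); imports TREE #132 `…AtlasReachLedger` + gen-3 `…TransportPriceSurplus` only; 0 sorry.  Tags: [new: junction]; the transport is [folklore, on tree].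
-/

noncomputable section

namespace Summit.AtomisticToContinuum.Crystallization.Theorems.FrustratedLawDichotomyAtlasReachSharing

open MeasureTheory Metric Set Filter
open scoped ENNReal BigOperators
open Literature.MathematicalPhysics.StatisticalMechanics Literature.Probability.Process
open Summit.AtomisticToContinuum.Crystallization.Theorems.ChargedEnergyGapNegative (E3 eStar)
open Summit.AtomisticToContinuum.Crystallization.Theorems.FrustratedLawDichotomyFiniteClusterGap (ae_mem_of_sep)
open Summit.AtomisticToContinuum.Crystallization.Theorems.FrustratedLawDichotomySignedLedger (net)
open Summit.AtomisticToContinuum.Crystallization.Theorems.FrustratedLawDichotomyTransportPriceLocal (rootEnergy_add_c0_nonneg rootEnergy_le_C0)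
open Summit.AtomisticToContinuum.Crystallization.Theorems.FrustratedLawDichotomyTransportPriceSurplus
  (sharing_transport exists_measurable_rootEnergy_surrogate)
open Summit.AtomisticToContinuum.Crystallization.Theorems.FrustratedLawDichotomyAtlasReach
  (reach CoherentMassExclusion OffAtlasMassGap aperiodicFrustratedLawGap_of_massSplit)
open Summit.AtomisticToContinuum.Crystallization.Theorems.FrustratedLawDichotomyAtlasReachLedger
  (net_nullLedger coherentMassExclusion_of_floorsL offAtlasMass_ge_of_floorsL)

/-! ## §1. The ball-averaged root energy -/

/-- ★ THE BALL-AVERAGED ROOT ENERGY at radius `r`: `Σ_{atoms y ∈ B̄_r(0)} (rootEnergy(θ_y μ) + c₀)/(θ_y μ)(B̄_r(0)) − c₀` with `c₀ = (250/12)(10/7)⁶`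
(each atom's shifted site energy, shared equally among the atoms of its own closed `r`-ball; the root collects its shares).  Written with `lintegral`s
against `μ` exactly as the in-flow of `…TransportPriceSurplus.sharing_transport`. [new: functional] -/
def ballAvgEnergy (r : ℝ) (μ : Measure E3) : ℝ :=
  (∫⁻ y in closedBall (0 : E3) r, ENNReal.ofReal (rootEnergy lennardJones (μ.map fun z : E3 => z - y) + 250 / 12 * (10 / 7) ^ 6) /
      (μ.map fun z : E3 => z - y) (closedBall (0 : E3) r) ∂μ).toReal - 250 / 12 * (10 / 7) ^ 6

/-- Under a rooted hard-core configuration almost every point (for `μ` itself) is an atom. [folklore] -/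
theorem ae_apply_singleton_ne_zero {δ : ℝ} (hδ : 0 < δ) {μ : Measure E3} (hμ : IsRootedHardCore δ μ) : ∀ᵐ y ∂μ, μ {y} ≠ 0 := by
  obtain ⟨S, -, hsep, hμS⟩ := id hμ
  rw [hμS]
  filter_upwards [ae_mem_of_sep hδ hsep] with y hy
  exact (count_restrict_singleton_ne_zero_iff S y).2 hy

/-- ★ THE IDENTITY: for a transport `F` with the two clauses of `sharing_transport` for the surrogate `H` of `rootEnergy + c₀`, the transported root energy
`rootEnergy μ + net F 0 μ` IS the ball-averaged root energy, at every rooted `7/10`-hard-core `μ`. [new: bookkeeping] -/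
theorem transported_eq_ballAvgEnergy {r : ℝ} {H : Measure E3 → ℝ}
    (hH : ∀ ν : Measure E3, IsRootedHardCore (7 / 10) ν → H ν = rootEnergy lennardJones ν - (-(250 / 12 * (10 / 7) ^ 6)))
    {F : Measure E3 → E3 → ℝ≥0∞} (hout : ∀ ν : Measure E3, IsRootedHardCore (7 / 10) ν → ∫⁻ y, F ν y ∂ν = ENNReal.ofReal (H ν))
    (hin : ∀ ν : Measure E3, ∫⁻ y, F (ν.map fun z : E3 => z - y) (-y) ∂ν =
      ∫⁻ y in closedBall (0 : E3) r, ENNReal.ofReal (H (ν.map fun z : E3 => z - y)) / (ν.map fun z : E3 => z - y) (closedBall (0 : E3) r) ∂ν)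
    {μ : Measure E3} (hμ : IsRootedHardCore (7 / 10) μ) :
    rootEnergy lennardJones μ + net F (fun _ _ => 0) μ = ballAvgEnergy r μ := by
  have h7 : (0 : ℝ) < 7 / 10 := by norm_num
  have hc0 := rootEnergy_add_c0_nonneg hμ
  have hout' : (∫⁻ y, F μ y ∂μ).toReal = rootEnergy lennardJones μ + 250 / 12 * (10 / 7) ^ 6 := by
    rw [hout μ hμ, hH μ hμ, sub_neg_eq_add, ENNReal.toReal_ofReal hc0]
  have hin' : ∫⁻ y, F (μ.map fun z : E3 => z - y) (-y) ∂μ =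
      ∫⁻ y in closedBall (0 : E3) r, ENNReal.ofReal (rootEnergy lennardJones (μ.map fun z : E3 => z - y) + 250 / 12 * (10 / 7) ^ 6) /
        (μ.map fun z : E3 => z - y) (closedBall (0 : E3) r) ∂μ := by
    rw [hin μ]
    refine lintegral_congr_ae (ae_restrict_of_ae ?_)
    filter_upwards [ae_apply_singleton_ne_zero h7 hμ] with y hy
    rw [hH _ (hμ.map_sub hy), sub_neg_eq_add]
  unfold net ballAvgEnergy
  rw [hout', hin']
  simp only [lintegral_zero, ENNReal.toReal_zero, sub_zero]
  ring

/-- The sharing transport of the shifted energy is an admissible NULL LEDGER: jointly measurable, out-flow `≤ C₀ + c₀` on rooted `7/10`-hard-core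
configurations, hence `net F 0` is integrable with mean `≤ 0` under every point-stationary probability law a.s. carried by such configurations
(#132 `net_nullLedger`, by name). [folklore: mass transport] -/
theorem sharing_nullLedger {H : Measure E3 → ℝ}
    (hH : ∀ ν : Measure E3, IsRootedHardCore (7 / 10) ν → H ν = rootEnergy lennardJones ν - (-(250 / 12 * (10 / 7) ^ 6)))
    {F : Measure E3 → E3 → ℝ≥0∞} (hF : Measurable (Function.uncurry F))
    (hout : ∀ ν : Measure E3, IsRootedHardCore (7 / 10) ν → ∫⁻ y, F ν y ∂ν = ENNReal.ofReal (H ν)) :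
    ∀ P : Measure (Measure E3), IsProbabilityMeasure P → (∀ᵐ μ ∂P, IsRootedHardCore (7 / 10) μ) → IsPointStationaryLaw P →
      Integrable (net F fun _ _ => 0) P ∧ ∫ μ, net F (fun _ _ => 0) μ ∂P ≤ 0 := by
  refine net_nullLedger F (fun _ _ => 0) hF measurable_const (BF := ENNReal.ofReal (250 / 24 * (10 / 7) ^ 12 + 250 / 12 * (10 / 7) ^ 6))
    (BG := 0) ENNReal.ofReal_ne_top ENNReal.zero_ne_top (fun μ hμ => ?_) (fun μ _ => by simp)
  rw [hout μ hμ, hH μ hμ, sub_neg_eq_add]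
  exact ENNReal.ofReal_le_ofReal (by linarith [rootEnergy_le_C0 hμ])

/-! ## §2. The reach theorem and the energy–mass inequality on the ball-averaged energy -/

/-- ★★ **THE REACH THEOREM WITH THE SHARING LEDGER.**  For any radius `r > 0`: row floors `e⋆ + m_i ≤ ballAvgEnergy r μ` at the rooted `7/10`-hard-core
Nash configurations of row `i < n` (margins `≥ m > 0`), and the cap `e⋆ − ballAvgEnergy r μ ≤ D` (`D ≥ 0`) ONLY at rooted `7/10`-hard-core Nash
configurations outside every row, prove F(η) for every `η ≤ reach m D` — #132 `coherentMassExclusion_of_floorsL` with `Φ :=` the net flow of the tree's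
sharing transport of the shifted energy. [new: junction] -/
theorem coherentMassExclusion_of_ballAvg {r : ℝ} (hr : 0 < r) (n : ℕ) (K : ℕ → Set (MeasureTheory.Measure (EuclideanSpace ℝ (Fin 3))))
    (hK : ∀ i, MeasurableSet (K i)) (mK : ℕ → ℝ)
    (hfloorA : ∀ i < n, ∀ μ : Measure E3, IsRootedHardCore (7 / 10) μ →
      (∀ p : E3, μ {p} ≠ 0 → ∀ y : E3, (∀ q : E3, μ {q} ≠ 0 → q ≠ p → y ≠ q) →
        ∑' q : {q : E3 // μ {q} ≠ 0 ∧ q ≠ p}, lennardJones (dist p (q : E3)) ≤ ∑' q : {q : E3 // μ {q} ≠ 0 ∧ q ≠ p}, lennardJones (dist y (q : E3))) →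
      μ ∈ K i → eStar + mK i ≤ ballAvgEnergy r μ)
    {m D : ℝ} (hm0 : 0 < m) (hD : 0 ≤ D) (hm : ∀ i < n, m ≤ mK i)
    (hcapA : ∀ μ : Measure E3, IsRootedHardCore (7 / 10) μ →
      (∀ p : E3, μ {p} ≠ 0 → ∀ y : E3, (∀ q : E3, μ {q} ≠ 0 → q ≠ p → y ≠ q) →
        ∑' q : {q : E3 // μ {q} ≠ 0 ∧ q ≠ p}, lennardJones (dist p (q : E3)) ≤ ∑' q : {q : E3 // μ {q} ≠ 0 ∧ q ≠ p}, lennardJones (dist y (q : E3))) →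
      μ ∉ (⋃ i ∈ Finset.range n, K i) → eStar - ballAvgEnergy r μ ≤ D)
    {η : ℝ} (hη : η ≤ reach m D) : CoherentMassExclusion n K η := by
  obtain ⟨H, hHm, hH⟩ := exists_measurable_rootEnergy_surrogate (-(250 / 12 * (10 / 7) ^ 6))
  obtain ⟨F, hF, hout, hin⟩ := sharing_transport (ENNReal.measurable_ofReal.comp hHm) hr
  refine coherentMassExclusion_of_floorsL n K hK mK (net F fun _ _ => 0) (sharing_nullLedger hH hF hout) (fun i hi μ hμ hN hμi => ?_) hm0 hD hm
    (fun μ hμ hN hμU => ?_) hη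
  · rw [transported_eq_ballAvgEnergy hH hout hin hμ]
    exact hfloorA i hi μ hμ hN hμi
  · rw [sub_sub, transported_eq_ballAvgEnergy hH hout hin hμ]
    exact hcapA μ hμ hN hμU

/-- ★★ JUNCTION TO THE CRUX: ball-averaged floors, the ball-averaged cap off the rows, and A(η) = `OffAtlasMassGap n K η` (`η ≤ reach m D`) prove
`AperiodicFrustratedLawGap` ((404) `aperiodicFrustratedLawGap_of_massSplit`, by name). [new: junction] -/
theorem aperiodicFrustratedLawGap_of_offAtlasMassGap_ballAvg {r : ℝ} (hr : 0 < r) (n : ℕ)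
    (K : ℕ → Set (MeasureTheory.Measure (EuclideanSpace ℝ (Fin 3)))) (hK : ∀ i, MeasurableSet (K i)) (mK : ℕ → ℝ)
    (hfloorA : ∀ i < n, ∀ μ : Measure E3, IsRootedHardCore (7 / 10) μ →
      (∀ p : E3, μ {p} ≠ 0 → ∀ y : E3, (∀ q : E3, μ {q} ≠ 0 → q ≠ p → y ≠ q) →
        ∑' q : {q : E3 // μ {q} ≠ 0 ∧ q ≠ p}, lennardJones (dist p (q : E3)) ≤ ∑' q : {q : E3 // μ {q} ≠ 0 ∧ q ≠ p}, lennardJones (dist y (q : E3))) →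
      μ ∈ K i → eStar + mK i ≤ ballAvgEnergy r μ)
    {m D : ℝ} (hm0 : 0 < m) (hD : 0 ≤ D) (hm : ∀ i < n, m ≤ mK i)
    (hcapA : ∀ μ : Measure E3, IsRootedHardCore (7 / 10) μ →
      (∀ p : E3, μ {p} ≠ 0 → ∀ y : E3, (∀ q : E3, μ {q} ≠ 0 → q ≠ p → y ≠ q) →
        ∑' q : {q : E3 // μ {q} ≠ 0 ∧ q ≠ p}, lennardJones (dist p (q : E3)) ≤ ∑' q : {q : E3 // μ {q} ≠ 0 ∧ q ≠ p}, lennardJones (dist y (q : E3))) →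
      μ ∉ (⋃ i ∈ Finset.range n, K i) → eStar - ballAvgEnergy r μ ≤ D)
    {η : ℝ} (hη : η ≤ reach m D) (hA : OffAtlasMassGap n K η) :
    Summit.AtomisticToContinuum.Crystallization.Theses.FrustratedLawDichotomy.AperiodicFrustratedLawGap :=
  aperiodicFrustratedLawGap_of_massSplit n K η (coherentMassExclusion_of_ballAvg hr n K hK mK hfloorA hm0 hD hm hcapA hη) hA

/-- ★ THE ENERGY–MASS INEQUALITY ON THE BALL-AVERAGED ENERGY (#132 §4 with the sharing ledger): ball-averaged row floors (margins `≥ m`), the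
ball-averaged cap off the rows, `0 < m + D` ⟹ every point-stationary probability law that is a.s. rooted `7/10`-hard-core and a.s. Nash with
`E_P[rootEnergy] ≤ e⋆ + ε` gives the uncovered set mass `≥ (m − ε)/(m + D)` — clauses (a)(b)(e) only. [new: junction] -/
theorem offAtlasMass_ge_of_ballAvg {r : ℝ} (hr : 0 < r) (n : ℕ) (K : ℕ → Set (MeasureTheory.Measure (EuclideanSpace ℝ (Fin 3))))
    (hK : ∀ i, MeasurableSet (K i)) (mK : ℕ → ℝ)
    (hfloorA : ∀ i < n, ∀ μ : Measure E3, IsRootedHardCore (7 / 10) μ →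
      (∀ p : E3, μ {p} ≠ 0 → ∀ y : E3, (∀ q : E3, μ {q} ≠ 0 → q ≠ p → y ≠ q) →
        ∑' q : {q : E3 // μ {q} ≠ 0 ∧ q ≠ p}, lennardJones (dist p (q : E3)) ≤ ∑' q : {q : E3 // μ {q} ≠ 0 ∧ q ≠ p}, lennardJones (dist y (q : E3))) →
      μ ∈ K i → eStar + mK i ≤ ballAvgEnergy r μ)
    {m D : ℝ} (hmD : 0 < m + D) (hm : ∀ i < n, m ≤ mK i)
    (hcapA : ∀ μ : Measure E3, IsRootedHardCore (7 / 10) μ →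
      (∀ p : E3, μ {p} ≠ 0 → ∀ y : E3, (∀ q : E3, μ {q} ≠ 0 → q ≠ p → y ≠ q) →
        ∑' q : {q : E3 // μ {q} ≠ 0 ∧ q ≠ p}, lennardJones (dist p (q : E3)) ≤ ∑' q : {q : E3 // μ {q} ≠ 0 ∧ q ≠ p}, lennardJones (dist y (q : E3))) →
      μ ∉ (⋃ i ∈ Finset.range n, K i) → eStar - ballAvgEnergy r μ ≤ D)
    (P : Measure (Measure E3)) [IsProbabilityMeasure P] (ha : ∀ᵐ μ ∂P, IsRootedHardCore (7 / 10) μ) (hb : IsPointStationaryLaw P)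
    (he : ∀ᵐ μ ∂P, ∀ p : E3, μ {p} ≠ 0 → ∀ y : E3, (∀ q : E3, μ {q} ≠ 0 → q ≠ p → y ≠ q) →
      ∑' q : {q : E3 // μ {q} ≠ 0 ∧ q ≠ p}, lennardJones (dist p (q : E3)) ≤ ∑' q : {q : E3 // μ {q} ≠ 0 ∧ q ≠ p}, lennardJones (dist y (q : E3)))
    {ε : ℝ} (hmean : ∫ μ, rootEnergy lennardJones μ ∂P ≤ eStar + ε) :
    (m - ε) / (m + D) ≤ P.real (⋃ i ∈ Finset.range n, K i)ᶜ := by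
  obtain ⟨H, hHm, hH⟩ := exists_measurable_rootEnergy_surrogate (-(250 / 12 * (10 / 7) ^ 6))
  obtain ⟨F, hF, hout, hin⟩ := sharing_transport (ENNReal.measurable_ofReal.comp hHm) hr
  refine offAtlasMass_ge_of_floorsL n K hK mK (net F fun _ _ => 0) (sharing_nullLedger hH hF hout) (fun i hi μ hμ hN hμi => ?_) hmD hm
    (fun μ hμ hN hμU => ?_) P ha hb he hmean
  · rw [transported_eq_ballAvgEnergy hH hout hin hμ]
    exact hfloorA i hi μ hμ hN hμi
  · rw [sub_sub, transported_eq_ballAvgEnergy hH hout hin hμ]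
    exact hcapA μ hμ hN hμU

end Summit.AtomisticToContinuum.Crystallization.Theorems.FrustratedLawDichotomyAtlasReachSharing

end
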